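import Summits.QuantumFields.BalabanUV.T4Continuum.Support.ShellMeasureExpJacobianSUN
import Literature.MeasureTheory.Lebesgue.PolynomialZeroSet
import Mathlib.MeasureTheory.Measure.Haar.InnerProductSpace

/-!
# `T4Continuum.ShellMeasureRegularConeSUN` — THE NON-REGULAR CONE OF THE EXPONENTIAL CHART OF `SU(N)` IS
# LEBESGUE-NULL: almost every chart point `v ∈ E_N` has a REGULAR unitary diagonalisation `herm v = U·diag θ·U*`,
# `∏_{i<j} (θ_j − θ_i) ≠ 0`
# (cell `pub-balaban`, sub-cell `t4`, spine estimate NE7c (node U5b); ROUND-2 crew `t4-ne7c-formalise-*`; the (CH)₁ line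
# for `SU(N)`, `N ≥ 3` — GAPS G-ne7cL04-1 (S3 f5's displayed `hCH`), HAUSDORFF ROUTE of seat
# `b2b-balaban-t4-ne7c-formalise-leaf-10` (gen 5): the cone-nullity brick that the area-formula file (AF)
# `ShellMeasureExpHaarAreaSUN.hCH_of_jacobian` and STEP 2 (`det T_v = expJacSU v` OFF the cone, leaf-09-g6) need to
# meet — S3 f4's discriminant-quotient Jacobian `expJacSU` is `0` ON the cone (`expJacSU_eq_zero`) while the true
# Jacobian is `∏ sinc² > 0` there, so the two agree only Lebesgue-a.e.; tree target
# `Summits/QuantumFields/BalabanUV/T4Continuum/Support/`; ADDITIVE — imports S3 f4 `ShellMeasureExpJacobianSUN` (`herm`,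
# `exists_conjDiag`, `ShellMeasureVandermondeSUN.disc`/`disc_conjDiag_re`), the tree's
# `Literature.MeasureTheory.Lebesgue.PolynomialZeroSet` (`MvPolynomial.volume_zeroSet_eq_zero_of_fintype`, Caron–Traynor)
# and Mathlib's `MeasureTheory.Measure.Haar.InnerProductSpace` (`PiLp.volume_preserving_ofLp`); modifies nothing)

HONEST FRAMING.  Finite four-torus programme, rung (B)+1 only — NOT infinite volume, NOT a mass gap, NOT the Clay
problem, NOT summit progress.  Nothing of [Balaban 1983–89] is mentioned or asserted; NE7c NOT proved and not touched
(spine PROVED 0/9); (CH)₁ for `N ≥ 3` stays DISPLAYED until (H) + (AF) + STEP 1 + STEP 2 + THIS are all in the tree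
and assembled (v1.1 status note: they are — (CH)₁ is a THEOREM for every `N ≥ 1`, `0 ≤ S ≤ π`:
`ShellMeasureExpHaarAreaSUN.haar_restrict_expBallSU`, `ShellMeasureExpHaarClosedBallSUN.haar_restrict_expBallSU_le`).
[folklore] linear algebra and measure theory, 0 sorry, 0 citations, no `def … : Prop` (the data defs
`discR`, `hermBasis`, `hermPoly`, `discPoly`, `rePoly`, `theta0`, `v0` are objects).
HONEST DEPENDENCY (cell, verbatim): continuum YM on T⁴ ⇐ BetaPertH ∧ nine spine estimates (0/9 proved); BetaPertH ⇐ (D1) ∧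
(D4) ∧ CAP+tail; G-an2-4 gates asym, D1 and NE2/3/4.

THE POINT (`volume_nonRegular_eq_zero`, `ae_exists_regular_conjDiag`).  For `[NeZero N]`:

  `volume {v : ChartSU N | Re disc (herm v) = 0} = 0`,  hence for a.e. `v` there are `U`, `θ` with
  `herm v = conjDiag U θ` and `∏ i, ∏ j ∈ Ioi i, (θ j − θ i) ≠ 0`

(`disc` = S3 f3's power-trace discriminant `det [tr H^{a+b}] = (∏_{i<j}(θ_j − θ_i))²`).  Proof: (§1) the
discriminant makes sense over any commutative ring and COMMUTES WITH RING HOMOMORPHISMS (`map_discR`: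
`RingHom.map_det`, `Matrix.map_pow`); (§2) the Hermitian generator is LINEAR in the chart coordinates,
`herm v = Σ_i v_i · B_i` (`herm_eq_sum`, `B_i = herm (e_i)`), so it is the evaluation at the (real) coordinates
`ofLp v` of a MATRIX OF LINEAR POLYNOMIALS `hermPoly = Σ_i X_i · B_i` with complex coefficients
(`hermPoly_map_eval`), and `disc (herm v)` is the evaluation of the polynomial `discPoly = discR hermPoly`
(`eval_discPoly`); the REAL PART of a complex polynomial at real points is the real polynomial of the real parts of its
coefficients (`rePoly`, `eval_rePoly`); (§3) `rePoly discPoly ≠ 0`, because at the chart point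
`v₀ = coordSU⁻¹ (i · diag θ₀)`, `θ₀_k = k − (N−1)/2` (trace-free, distinct entries), `herm v₀ = diag θ₀` and
`Re disc = (∏_{i<j} (θ₀_j − θ₀_i))² ≠ 0` (`disc_herm_v0_re_ne_zero`); (§4) the zero set of a non-zero real polynomial
is Lebesgue-null (the tree's `MvPolynomial.volume_zeroSet_eq_zero_of_fintype`), transported to `E_N` along the
volume-preserving coordinate map `ofLp` (Mathlib `PiLp.volume_preserving_ofLp`); the a.e. regular diagonalisation
follows with `exists_conjDiag` and `disc_conjDiag_re`.

WHAT THIS DOES NOT DO.  No Jacobian, no measure identity on the group; (CH)₁ NOT discharged here; nothing of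
Bałaban's; NE7c NOT proved.
-/

noncomputable section

namespace Summit.QuantumFields.BalabanUV.T4Continuum.ShellMeasureRegularConeSUN

open MeasureTheory Matrix Finset MvPolynomial
open Literature.MathematicalPhysics.QuantumFieldTheory.Balaban1983to89
open T4AdjointCovarianceUnitary (lieSU mem_lieSU_iff)
open ShellMeasureExpChartSUN ShellMeasureExpJacobianSUN ShellMeasureVandermondeSUN

variable {N : ℕ}

/-! ## §1 The discriminant over a commutative ring commutes with ring homomorphisms -/

section Generic

/-- the power-trace discriminant `det [tr A^{a+b}]` over ANY commutative ring (over `ℂ` it is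
`ShellMeasureVandermondeSUN.disc`, by `rfl`). [folklore] -/
def discR {R : Type*} [CommRing R] (A : Matrix (Fin N) (Fin N) R) : R :=
  det (of fun a b : Fin N => trace (A ^ ((a : ℕ) + b)))

/-- over `ℂ` the generic discriminant is the tree's `disc`. [folklore] -/
theorem discR_eq_disc (A : Matrix (Fin N) (Fin N) ℂ) : discR A = disc A := rfl

/-- **ring homomorphisms commute with the discriminant**: `φ (discR A) = discR (A.map φ)`. [folklore] -/
theorem map_discR {R S : Type*} [CommRing R] [CommRing S] (φ : R →+* S) (A : Matrix (Fin N) (Fin N) R) :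
    φ (discR A) = discR (A.map φ) := by
  unfold discR
  rw [RingHom.map_det]
  congr 1
  ext a b
  rw [RingHom.mapMatrix_apply, map_apply, of_apply, of_apply, ← Matrix.map_pow]
  simp only [Matrix.trace, Matrix.diag, map_sum, map_apply]

end Generic

/-! ## §2 The Hermitian generator is linear in the chart coordinates: a matrix of linear polynomials -/

section Poly

/-- `herm` is additive. [folklore] -/
theorem herm_add (v w : ChartSU N) : herm (v + w) = herm v + herm w := by
  unfold herm
  rw [genSU_add, smul_add]

/-- `herm` of a finite sum. [folklore] -/
theorem herm_sum {ι : Type*} (s : Finset ι) (f : ι → ChartSU N) : herm (∑ i ∈ s, f i) = ∑ i ∈ s, herm (f i) := by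
  classical
  induction s using Finset.induction_on with
  | empty => simp [herm, genSU_zero]
  | insert a s ha ih => rw [sum_insert ha, sum_insert ha, herm_add, ih]

/-- THE COORDINATE GENERATORS `B_i = herm (e_i)` of the chart (`e_i` the `i`-th coordinate vector of `E_N`). [folklore] -/
def hermBasis (i : Fin (dimSU N)) : Matrix (Fin N) (Fin N) ℂ := herm (WithLp.toLp 2 fun j => if i = j then (1 : ℝ) else 0)

/-- **`herm v = Σ_i v_i · B_i`** in the chart coordinates `v_i = (ofLp v) i`. [folklore] -/
theorem herm_eq_sum (v : ChartSU N) : herm v = ∑ i, ((WithLp.ofLp v i : ℝ) : ℂ) • hermBasis i := by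
  classical
  have hv : v = ∑ i, (WithLp.ofLp v i) • WithLp.toLp 2 (fun j => if i = j then (1 : ℝ) else 0) := by
    apply (WithLp.ofLp_injective 2)
    rw [WithLp.ofLp_sum]
    conv_lhs => rw [pi_eq_sum_univ (WithLp.ofLp v)]
    refine sum_congr rfl fun i _ => ?_
    rw [WithLp.ofLp_smul, WithLp.ofLp_toLp]
  conv_lhs => rw [hv]
  rw [herm_sum]
  refine sum_congr rfl fun i _ => ?_
  rw [herm_smul]
  rfl

variable (N) in
/-- THE GENERATOR AS A MATRIX OF LINEAR POLYNOMIALS in the `d_N` chart coordinates: `Σ_i X_i · B_i`. [folklore] -/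
def hermPoly : Matrix (Fin N) (Fin N) (MvPolynomial (Fin (dimSU N)) ℂ) :=
  ∑ i, (X i : MvPolynomial (Fin (dimSU N)) ℂ) • (hermBasis (N := N) i).map C

/-- evaluating the polynomial generator at the (real) coordinates of `v` gives `herm v`. [folklore] -/
theorem hermPoly_map_eval (v : ChartSU N) :
    (hermPoly N).map (MvPolynomial.eval fun i => ((WithLp.ofLp v i : ℝ) : ℂ)) = herm v := by
  rw [herm_eq_sum]
  ext a b
  simp only [hermPoly, map_apply, Matrix.sum_apply, Matrix.smul_apply, smul_eq_mul, map_sum, map_mul,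
    MvPolynomial.eval_X, MvPolynomial.eval_C]

variable (N) in
/-- THE DISCRIMINANT POLYNOMIAL of the chart: `discR (hermPoly)`, a complex polynomial in the `d_N` coordinates.
[folklore] -/
def discPoly : MvPolynomial (Fin (dimSU N)) ℂ := discR (hermPoly N)

/-- **the discriminant of `herm v` is the discriminant polynomial evaluated at the coordinates of `v`.** [folklore] -/
theorem eval_discPoly (v : ChartSU N) :
    MvPolynomial.eval (fun i => ((WithLp.ofLp v i : ℝ) : ℂ)) (discPoly N) = disc (herm v) := by
  rw [discPoly, map_discR, hermPoly_map_eval, discR_eq_disc]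

/-! ### the real part of a complex polynomial at real points is a real polynomial -/

/-- THE REAL-PART POLYNOMIAL of a complex polynomial (coefficientwise real parts). [folklore] -/
def rePoly {σ : Type*} (P : MvPolynomial σ ℂ) : MvPolynomial σ ℝ :=
  ∑ m ∈ P.support, monomial m (P.coeff m).re

/-- **at REAL points, `Re (P (x)) = (rePoly P) (x)`.** [folklore] -/
theorem eval_rePoly {σ : Type*} (P : MvPolynomial σ ℂ) (x : σ → ℝ) :
    MvPolynomial.eval x (rePoly P) = (MvPolynomial.eval (fun i => ((x i : ℝ) : ℂ)) P).re := by
  rw [rePoly, map_sum, MvPolynomial.eval_eq, Complex.re_sum]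
  refine sum_congr rfl fun m _ => ?_
  rw [eval_monomial, Finsupp.prod]
  have h : (∏ i ∈ m.support, ((x i : ℝ) : ℂ) ^ m i) = ((∏ i ∈ m.support, x i ^ m i : ℝ) : ℂ) := by
    push_cast; rfl
  rw [h, Complex.re_mul_ofReal]

end Poly

/-! ## §3 A regular point: the discriminant polynomial's real part is not the zero polynomial -/

section Regular

variable [NeZero N]

/-- A TRACE-FREE REAL DIAGONAL with DISTINCT entries: `θ₀ k = k − (N − 1)/2`. [folklore] -/
def theta0 (k : Fin N) : ℝ := (k : ℝ) - ((N : ℝ) - 1) / 2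

omit [NeZero N] in
/-- `θ₀` has distinct entries. [folklore] -/
theorem theta0_sub_ne_zero {i j : Fin N} (h : i ≠ j) : theta0 j - theta0 i ≠ 0 := by
  unfold theta0
  have : (i : ℝ) ≠ (j : ℝ) := by exact_mod_cast Fin.val_ne_of_ne h
  intro hc
  apply this
  linarith

/-- `Σ_k θ₀ k = 0`. [folklore] -/
theorem sum_theta0 : ∑ k : Fin N, theta0 k = 0 := by
  unfold theta0
  rw [sum_sub_distrib, sum_const, card_univ, Fintype.card_fin, nsmul_eq_mul]
  have h : ∑ k : Fin N, (k : ℝ) = (N : ℝ) * ((N : ℝ) - 1) / 2 := by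
    have h1 := Finset.sum_range_id_mul_two N
    have h2 : ∑ k : Fin N, (k : ℝ) = ((∑ k ∈ Finset.range N, k : ℕ) : ℝ) := by
      rw [Fin.sum_univ_eq_sum_range (fun k => (k : ℝ)) N]; push_cast; rfl
    rw [h2]
    have hN : 1 ≤ N := NeZero.one_le
    have h3 : ((∑ k ∈ Finset.range N, k : ℕ) : ℝ) * 2 = (N : ℝ) * ((N : ℝ) - 1) := by
      rw [← Nat.cast_ofNat, ← Nat.cast_mul, h1]; push_cast [Nat.cast_sub hN]; ring
    linarith
  rw [h]; ring

/-- THE REGULAR GENERATOR `Z₀ = i · diag θ₀ ∈ 𝔰𝔲(N)`. [folklore] -/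
theorem I_smul_diagonal_theta0_mem : (Complex.I • diagonal fun k => ((theta0 (N := N) k : ℝ) : ℂ)) ∈ lieSU (Fin N) := by
  rw [mem_lieSU_iff]
  refine ⟨?_, ?_⟩
  · have hst : (star fun k : Fin N => ((theta0 k : ℝ) : ℂ)) = fun k => ((theta0 k : ℝ) : ℂ) :=
      funext fun k => by rw [Pi.star_apply, Complex.star_def, Complex.conj_ofReal]
    rw [star_eq_conjTranspose, conjTranspose_smul, diagonal_conjTranspose, hst, Complex.star_def, Complex.conj_I,
      neg_smul]
  · rw [trace_smul, trace_diagonal, ← Complex.ofReal_sum, sum_theta0, Complex.ofReal_zero, smul_zero]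

/-- THE REGULAR CHART POINT `v₀ = coordSU⁻¹ (i · diag θ₀)`. [folklore] -/
def v0 : ChartSU N := (coordSU (N := N)).symm ⟨_, I_smul_diagonal_theta0_mem⟩

/-- `herm v₀ = diag θ₀ = conjDiag 1 θ₀`. [folklore] -/
theorem herm_v0 : herm (v0 (N := N)) = conjDiag 1 fun k => ((theta0 k : ℝ) : ℂ) := by
  have h1 : genSU (v0 (N := N)) = Complex.I • diagonal fun k => ((theta0 k : ℝ) : ℂ) := by
    unfold v0 genSU
    rw [LinearIsometryEquiv.apply_symm_apply]
  have h2 : conjDiag (1 : Matrix.unitaryGroup (Fin N) ℂ) (fun k => ((theta0 k : ℝ) : ℂ)) =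
      diagonal fun k => ((theta0 k : ℝ) : ℂ) := by
    unfold conjDiag
    rw [OneMemClass.coe_one, star_one, Matrix.one_mul, Matrix.mul_one]
  rw [h2, herm, h1, smul_smul, neg_mul, Complex.I_mul_I, neg_neg, one_smul]

/-- **at `v₀` the discriminant is non-zero**: `Re disc (herm v₀) = (∏_{i<j} (θ₀_j − θ₀_i))² ≠ 0`. [folklore] -/
theorem disc_herm_v0_re_ne_zero : (disc (herm (v0 (N := N)))).re ≠ 0 := by
  rw [herm_v0, disc_conjDiag_re]
  refine pow_ne_zero 2 (prod_ne_zero_iff.mpr fun i _ => prod_ne_zero_iff.mpr fun j hj => ?_)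
  exact theta0_sub_ne_zero (ne_of_lt (mem_Ioi.mp hj)).symm.symm

/-- **the real-part discriminant polynomial is NOT the zero polynomial.** [folklore] -/
theorem rePoly_discPoly_ne_zero : rePoly (discPoly N) ≠ 0 := by
  intro h
  have h1 := eval_rePoly (discPoly N) (WithLp.ofLp (v0 (N := N)))
  rw [h, map_zero, eval_discPoly] at h1
  exact disc_herm_v0_re_ne_zero h1.symm

end Regular

/-! ## §4 The non-regular cone is Lebesgue-null -/

section Null

variable [NeZero N]

/-- **THE NON-REGULAR CONE `{v : Re disc (herm v) = 0}` IS LEBESGUE-NULL** (the zero set of a non-zero real polynomial,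
`MvPolynomial.volume_zeroSet_eq_zero_of_fintype`, transported along the volume-preserving coordinates `ofLp`).
[folklore] -/
theorem volume_nonRegular_eq_zero :
    (volume : Measure (ChartSU N)) {v | (disc (herm v)).re = 0} = 0 := by
  have hT : (volume : Measure (Fin (dimSU N) → ℝ)) {x | MvPolynomial.eval x (rePoly (discPoly N)) = 0} = 0 :=
    MvPolynomial.volume_zeroSet_eq_zero_of_fintype _ rePoly_discPoly_ne_zero
  have hmeas : MeasurableSet {x : Fin (dimSU N) → ℝ | MvPolynomial.eval x (rePoly (discPoly N)) = 0} :=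
    (isClosed_eq (MvPolynomial.continuous_eval _) continuous_const).measurableSet
  have hset : {v : ChartSU N | (disc (herm v)).re = 0} =
      (WithLp.ofLp : ChartSU N → Fin (dimSU N) → ℝ) ⁻¹' {x | MvPolynomial.eval x (rePoly (discPoly N)) = 0} := by
    ext v
    simp only [Set.mem_setOf_eq, Set.mem_preimage]
    rw [eval_rePoly, eval_discPoly]
  rw [hset, (PiLp.volume_preserving_ofLp (Fin (dimSU N))).measure_preimage hmeas.nullMeasurableSet, hT]

/-- **ALMOST EVERY CHART POINT IS REGULAR** (a.e. form). [folklore] -/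
theorem ae_disc_herm_re_ne_zero : ∀ᵐ v ∂(volume : Measure (ChartSU N)), (disc (herm v)).re ≠ 0 := by
  rw [ae_iff]
  simpa only [not_not] using volume_nonRegular_eq_zero (N := N)

/-- **ALMOST EVERY CHART POINT HAS A REGULAR UNITARY DIAGONALISATION** — the form STEP 2 (`det T_v = expJacSU v` off
the cone) and the area-formula file (AF) consume: for a.e. `v` there are `U`, `θ` with `herm v = U·diag θ·U*` and
`∏_{i<j} (θ_j − θ_i) ≠ 0`. [folklore] -/
theorem ae_exists_regular_conjDiag : ∀ᵐ v ∂(volume : Measure (ChartSU N)),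
    ∃ (U : Matrix.unitaryGroup (Fin N) ℂ) (θ : Fin N → ℝ),
      herm v = conjDiag U (fun k => (θ k : ℂ)) ∧ ∏ i : Fin N, ∏ j ∈ Ioi i, (θ j - θ i) ≠ 0 := by
  filter_upwards [ae_disc_herm_re_ne_zero (N := N)] with v hv
  obtain ⟨U, θ, h⟩ := exists_conjDiag v
  refine ⟨U, θ, h, fun hprod => hv ?_⟩
  rw [h, disc_conjDiag_re, hprod, zero_pow two_ne_zero]

end Null

end Summit.QuantumFields.BalabanUV.T4Continuum.ShellMeasureRegularConeSUN

end
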